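import Mathlib.MeasureTheory.Measure.Lebesgue.EqHaar
import Literature.MathematicalPhysics.QuantumFieldTheory.Balaban1983to89.T4ShellMeasure

/-!
# N21 (NE7c) · the RADIAL INPUTS about the background are elementary (lens Card 70 ∕ ROW D′), and large-field letters
# under inward dilation (lens Card 71)

R134 seat pub-ymgap-dag-n21-d (g8), node N21 = NE7c (single-run shell-weight bound, NOT PRINTED in [Bałaban 1983–89],
NOT proved), lane K3⁷ `SpineGivenEndpointR13SepCoPH` (stmt-QuantumFields-20544, `--kind proof --supports … --as helper`).
Part 20 of the comparison series.  THIS FILE = the §R + §X sections of the lens's `Sketch-nearmiss-g24.lean` (sha16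
85981f4eed0c46af, farm rc 0 · 0 warnings at the lens desk) VERBATIM — statements and proofs — re-homed in this
namespace (companion of part 19 `…N21DilationTransversal` = §D).  AUTHORSHIP OF THE MATHEMATICS: planner seat
`ym-lens-BalabanUVNodes-nearmiss` g24 (memo-only seat, cannot file); this seat only files.

WHAT (lens Cards 70–71).  §R: about the background the cube statistic is affine-radial `‖c + F z‖`; its radial
transversality (`affine_radialTransversal`: `κa = a − ‖c‖`), no-exit under inward dilation (`affine_noExit`), lower
scaling (`affine_lower_scaling`), the perturbed version (`affine_radialTransversal_perturbed`), cube sups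
(`radialTransversal_iSup`, `noExit_iSup`) and radial monotonicity of an action whose quadratic part dominates the
remainder (`radialMono_of_quadratic_dominates`) — the hypothesis shapes of part 19.  §X: `smul_mem_geCut_env` — a
`≥`-cut (large-field letter) exited under inward dilation lands in a LEFT shell of the large-field statistic of relative
width `τ(1 + c₀∕θ″)` (the envelope of Card 71; its mass is a pre-shell quantity of parts 14–15's species).

HONEST FRAMING.  [textbook] normed-space algebra; 0 def, 0 sorry; the located numbers (`c₀∕θ`, `γ`, `C₃ε∕γ₀`) are
NOT supplied here; nothing of Bałaban's asserted; NE7c NOT PRINTED ∕ NOT proved; N21 NOT discharged; counts unmoved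
(typed 28∕28 · discharged 5∕27); count-neutral; one finite 𝕋⁴ at fixed ε — nothing about ℝ⁴ ∕ OS ∕ mass gap ∕ Clay.
-/

open MeasureTheory Set Function Module
open scoped ENNReal NNReal Pointwise

namespace Summit.QuantumFields.YangMills.Theorems.N21DilationRadialInputs

variable {ι : Type*} [Fintype ι]

/-! ## §R The radial inputs about the background (Card 70) -/

section Affine

variable {X E : Type*} [AddCommGroup X] [Module ℝ X] [NormedAddCommGroup E] [NormedSpace ℝ E]

/-- **AFFINE-RADIAL LETTERS ARE RADIALLY TRANSVERSAL.**  `u z = ‖c + f z‖`, `f` linear (the tested statistic about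
the BACKGROUND: `c` = the background's own field at the letter, `f` = the linearised response): for `s ≥ 1`,
`u(s•z) ≥ u z + (s − 1)(u z − ‖c‖)` — so on a shell `{a ≤ u < b}` the constant is `κa = a − ‖c‖`. [textbook] -/
theorem affine_radialTransversal (c : E) (f : X →ₗ[ℝ] E) (z : X) {s : ℝ} (hs : 1 ≤ s) :
    ‖c + f z‖ + (s - 1) * (‖c + f z‖ - ‖c‖) ≤ ‖c + f (s • z)‖ := by
  have hdec : c + f (s • z) = s • (c + f z) - (s - 1) • c := by
    rw [map_smul, smul_add, sub_smul, one_smul]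
    abel
  rw [hdec]
  have h1 : ‖s • (c + f z)‖ - ‖(s - 1) • c‖ ≤ ‖s • (c + f z) - (s - 1) • c‖ := norm_sub_norm_le _ _
  rw [norm_smul_of_nonneg (by linarith), norm_smul_of_nonneg (by linarith)] at h1
  linarith

/-- **… AND DO NOT EXIT UNDER INWARD DILATION** (convexity along the ray): for `0 ≤ l ≤ 1`,
`u(l•z) ≤ max ‖c‖ (u z)`; so a sub-level cut `{u < θ}` with `‖c‖ < θ` (the background strictly inside the cut —
LEVEL THRESHOLD SEPARATION, [LF-I] p. 178 (1.3) vs (1.4)) is star-shaped about the background. [textbook] -/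
theorem affine_noExit (c : E) (f : X →ₗ[ℝ] E) (z : X) {l : ℝ} (hl0 : 0 ≤ l) (hl1 : l ≤ 1) :
    ‖c + f (l • z)‖ ≤ max ‖c‖ ‖c + f z‖ := by
  have hdec : c + f (l • z) = (1 - l) • c + l • (c + f z) := by
    rw [map_smul, smul_add, sub_smul, one_smul]
    abel
  rw [hdec]
  calc ‖(1 - l) • c + l • (c + f z)‖ ≤ ‖(1 - l) • c‖ + ‖l • (c + f z)‖ := norm_add_le _ _
    _ = (1 - l) * ‖c‖ + l * ‖c + f z‖ := by
        rw [norm_smul_of_nonneg (by linarith), norm_smul_of_nonneg hl0]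
    _ ≤ (1 - l) * max ‖c‖ ‖c + f z‖ + l * max ‖c‖ ‖c + f z‖ :=
        add_le_add (mul_le_mul_of_nonneg_left (le_max_left _ _) (by linarith))
          (mul_le_mul_of_nonneg_left (le_max_right _ _) hl0)
    _ = max ‖c‖ ‖c + f z‖ := by ring

/-- lower scaling of an affine-radial letter under inward dilation: `u(l•z) ≥ l·u(z) − (1−l)‖c‖` (`0 ≤ l ≤ 1`) — used
for the LEFT shell that receives the exits of a `≥`-cut (§X). [textbook] -/
theorem affine_lower_scaling (c : E) (f : X →ₗ[ℝ] E) (z : X) {l : ℝ} (hl0 : 0 ≤ l) (hl1 : l ≤ 1) :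
    l * ‖c + f z‖ - (1 - l) * ‖c‖ ≤ ‖c + f (l • z)‖ := by
  have hdec : c + f (l • z) = l • (c + f z) + (1 - l) • c := by
    rw [map_smul, smul_add, sub_smul, one_smul]
    abel
  rw [hdec]
  have h1 : ‖l • (c + f z)‖ - ‖(1 - l) • c‖ ≤ ‖l • (c + f z) + (1 - l) • c‖ := by
    have := norm_sub_norm_le (l • (c + f z)) (-((1 - l) • c))
    rwa [norm_neg, sub_neg_eq_add] at this
  rw [norm_smul_of_nonneg hl0, norm_smul_of_nonneg (by linarith)] at h1
  linarith

/-- **… WITH A NONLINEAR CORRECTION** `G` of radial Lipschitz constant `γ` at `z` (`‖G(s•z) − G z‖ ≤ γ(s−1)`; for the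
BCH ∕ minimiser nonlinearity `γ ≍ C·(field size)²`): `u z = ‖c + f z + G z‖` satisfies
`u(s•z) ≥ u z + (s−1)(u z − ‖c‖ − ‖G z‖ − γ)`.  So `κa = a − (‖c‖ + ‖G z‖ + γ)`: three located numbers. [textbook] -/
theorem affine_radialTransversal_perturbed (c : E) (f : X →ₗ[ℝ] E) (G : X → E) (z : X) {s γ : ℝ} (hs : 1 ≤ s)
    (hG : ‖G (s • z) - G z‖ ≤ γ * (s - 1)) :
    ‖c + f z + G z‖ + (s - 1) * (‖c + f z + G z‖ - ‖c‖ - ‖G z‖ - γ) ≤ ‖c + f (s • z) + G (s • z)‖ := by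
  have hdec : c + f (s • z) + G (s • z)
      = s • (c + f z + G z) - ((s - 1) • c + (s - 1) • G z - (G (s • z) - G z)) := by
    rw [map_smul, smul_add, smul_add, sub_smul, one_smul, sub_smul, one_smul]
    abel
  rw [hdec]
  have h1 : ‖s • (c + f z + G z)‖ - ‖(s - 1) • c + (s - 1) • G z - (G (s • z) - G z)‖
      ≤ ‖s • (c + f z + G z) - ((s - 1) • c + (s - 1) • G z - (G (s • z) - G z))‖ := norm_sub_norm_le _ _
  have h2 : ‖(s - 1) • c + (s - 1) • G z - (G (s • z) - G z)‖
      ≤ (s - 1) * ‖c‖ + (s - 1) * ‖G z‖ + γ * (s - 1) := by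
    calc ‖(s - 1) • c + (s - 1) • G z - (G (s • z) - G z)‖
        ≤ ‖(s - 1) • c + (s - 1) • G z‖ + ‖G (s • z) - G z‖ := norm_sub_le _ _
      _ ≤ ‖(s - 1) • c‖ + ‖(s - 1) • G z‖ + ‖G (s • z) - G z‖ := add_le_add (norm_add_le _ _) le_rfl
      _ ≤ (s - 1) * ‖c‖ + (s - 1) * ‖G z‖ + γ * (s - 1) := by
          rw [norm_smul_of_nonneg (by linarith), norm_smul_of_nonneg (by linarith)]
          linarith
  rw [norm_smul_of_nonneg (by linarith)] at h1
  nlinarith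

end Affine

/-- **A CUBE SUP INHERITS RADIAL TRANSVERSALITY** (finite family; take the letter attaining the sup). [textbook] -/
theorem radialTransversal_iSup {X P : Type*} [Fintype P] [Nonempty P] (u : P → X → ℝ) {c₀ s : ℝ}
    (z z' : X) (h : ∀ p, u p z + (s - 1) * (u p z - c₀) ≤ u p z') :
    (⨆ p, u p z) + (s - 1) * ((⨆ p, u p z) - c₀) ≤ ⨆ p, u p z' := by
  obtain ⟨p₀, hp₀⟩ := exists_eq_ciSup_of_finite (f := fun p => u p z)
  have h1 : u p₀ z' ≤ ⨆ p, u p z' := le_ciSup (Finite.bddAbove_range fun p => u p z') p₀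
  have h2 := h p₀
  rw [hp₀] at h2
  exact h2.trans h1

/-- **… AND INHERITS NO-EXIT.** [textbook] -/
theorem noExit_iSup {X P : Type*} [Fintype P] [Nonempty P] (u : P → X → ℝ) {c₀ : ℝ} (z z' : X)
    (h : ∀ p, u p z' ≤ max c₀ (u p z)) : (⨆ p, u p z') ≤ max c₀ (⨆ p, u p z) :=
  ciSup_le fun p => (h p).trans (max_le_max le_rfl (le_ciSup (Finite.bddAbove_range fun p => u p z) p))

/-- **RADIAL MONOTONICITY OF THE ACTION ABOUT ITS CONSTRAINED MINIMISER ⇐ THE QUADRATIC PART DOMINATES THE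
REMAINDER'S RADIAL VARIATION.**  `A = A₀ + q + R` with `q` 2-homogeneous and `≥ 0` (the fluctuation form: positive,
[LF-II] (1.3)–(1.9), [15] (190)) and `|R(l•z) − R z| ≤ (1−l)·q z` on the region (`R` = cubic and higher: radial
variation `≲ C₃·(field size)·Σ|z_b|²`, LOCAL smallness `C₃ε ≤ γ₀` suffices — no block-size dependence); then
`A(l•z) ≤ A z` for `l ∈ [1−τ, 1] ⊆ [0, 1]`. [textbook] -/
theorem radialMono_of_quadratic_dominates {X : Type*} [AddCommGroup X] [Module ℝ X] (A₀ : ℝ) (q R : X → ℝ)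
    (hq2 : ∀ (l : ℝ) (z : X), q (l • z) = l ^ 2 * q z) (hq0 : ∀ z, 0 ≤ q z) {K : Set X} {τ : ℝ} (hτ : τ ≤ 1)
    (hR : ∀ z ∈ K, ∀ l ∈ Icc (1 - τ) 1, |R (l • z) - R z| ≤ (1 - l) * q z) :
    ∀ z ∈ K, ∀ l ∈ Icc (1 - τ) 1, A₀ + q (l • z) + R (l • z) ≤ A₀ + q z + R z := by
  intro z hz l hl
  have hl0 : 0 ≤ l := by linarith [hl.1]
  have h1 := hR z hz l hl
  have h2 : R (l • z) ≤ R z + (1 - l) * q z := by linarith [(abs_le.1 h1).2]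
  rw [hq2]
  have h3 : l ^ 2 * q z + (1 - l) * q z ≤ q z := by
    have : l ^ 2 ≤ l := by nlinarith [hl.2]
    nlinarith [hq0 z]
  linarith

/-! ## §X Large-field letters under inward dilation (Card 71) -/

/-- **A `≥`-CUT'S EXITS LAND IN A LEFT SHELL OF RELATIVE WIDTH `τ(1 + c₀∕θ'')`.**  For a letter with the lower scaling
`u''(l•z) ≥ l·u''(z) − (1−l)c₀` (affine-radial: `affine_lower_scaling`) and `l ∈ [1−τ, 1]`: the inward dilate
of a point of the large-field cut `{u'' ≥ θ''}` (`τ ≤ 1`) lies in `{u'' ≥ θ''} ∪ {(1−τ)θ'' − τc₀ ≤ u'' < θ''}` — so for a block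
read by a LARGE-field letter the envelope exceeds the support by a thin LEFT shell of that letter, whose odds against
the support (`measure_env_le_of_odds`) is a rightward hazard quantity of road II (G8/G12 species), NOT a large-field
improbability. [textbook] -/
theorem smul_mem_geCut_env {X : Type*} [AddCommGroup X] [Module ℝ X] {u : X → ℝ} {c₀ θ τ : ℝ} (hτ : τ ≤ 1)
    (hc₀ : 0 ≤ c₀) (hθ : 0 ≤ θ)
    (hlow : ∀ l ∈ Icc (1 - τ) 1, ∀ z, l * u z - (1 - l) * c₀ ≤ u (l • z))
    {l : ℝ} (hl : l ∈ Icc (1 - τ) 1) {z : X} (hz : θ ≤ u z) :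
    l • z ∈ {x | θ ≤ u x} ∪ {x | (1 - τ) * θ - τ * c₀ ≤ u x ∧ u x < θ} := by
  by_cases h : θ ≤ u (l • z)
  · exact Or.inl h
  · refine Or.inr ⟨?_, lt_of_not_ge h⟩
    have h1 := hlow l hl z
    have hl0 : 0 ≤ l := by linarith [hl.1, hτ]
    have h2 : (1 - τ) * θ ≤ l * u z := by
      calc (1 - τ) * θ ≤ l * θ := mul_le_mul_of_nonneg_right hl.1 hθ
        _ ≤ l * u z := mul_le_mul_of_nonneg_left hz hl0
    have h3 : (1 - l) * c₀ ≤ τ * c₀ := mul_le_mul_of_nonneg_right (by linarith [hl.1]) hc₀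
    linarith

end Summit.QuantumFields.YangMills.Theorems.N21DilationRadialInputs
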